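import Literature.Geometry.Lorentzian.MinkowskiRadialMultiplier
import Summits.FinalStateConjecture.FinalStateConjecture.Theorems.ClusterCompletenessAdiabaticMultiKerrILEDFlatMorawetzBulk

/-!
# Route ClusterCompleteness — crux `AdiabaticMultiKerrILED`, line `Sketch`: the mid-frame wall bulk identity

Helper file for the crux `stmt-FinalStateConjecture-14310` (line `Sketch`, research stub
`stub_lateEnergyBound_pos`): the deformation bulk of a **blended boosted-Killing multiplier**
`X = u + ζ · W` on Minkowski space (`u`, `W` constant component vectors, `ζ` a scalar transition
function), and its **mid-frame wall form**: if the blend is between the two frames of a receding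
pair written in the pair's mid-frame (`W = u₂ − u₁ = κ ŵ` purely spatial, `ŵ` a unit vector) across
a wall at rest in that frame (`dζ = ζ′ ŵ♭`), then
`K^X = κ ζ′ [ (∂_ŵ w)² − ½ η^{αβ} ∂_α w ∂_β w ] = ½ κ ζ′ [ (∂₀w)² + (∂_ŵ w)² − |∇_⊥ w|² ]`,
which for null `dw` (geometric optics / null dust) is the perfect square `κ ζ′ (∂_ŵ w)² ≥ 0`:
every wall crossing lowers the multi-frame energy (the wave-level Doppler budget of the line,
crux notes §2). Dafermos–Rodnianski arXiv:0811.0354, App. D (the bulk `K^V = ½ T^{μν}(𝓛_V g)_{μν}`);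
the identities themselves are elementary algebra. [folklore]
-/

noncomputable section

-- the doubled `FinalStateConjecture.FinalStateConjecture` path component trips dupNamespace
set_option linter.dupNamespace false

open scoped BigOperators
open Literature.Geometry.Lorentzian

namespace Summit.FinalStateConjecture.FinalStateConjecture.Cruxes.AdiabaticMultiKerrILED.Sketch

/-- **Bulk of a blended constant multiplier on Minkowski space.** For constant component vectors
`u`, `W` and a scalar `ζ` differentiable at `x`, the multiplier `X = u + ζ W` has
`K^X = (∑_μ A^μ ∂_μζ) · W(w) − ½ W(ζ) · Q`, `A^μ = ∑_ν η^{μν} ∂_ν w`, `W(w) = ∑_α W^α ∂_α w`,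
`Q = ∑ η^{αβ} ∂_α w ∂_β w` (i.e. `K^X = T(dζ♯, W)`; `∂η = 0`, `∂X^β = ∂ζ W^β`).
Dafermos–Rodnianski arXiv:0811.0354, App. D. [folklore] -/
theorem multiplierBulk_eta_blend (u W : Fin 4 → ℝ) {ζ : E4 → ℝ} (w : E4 → ℝ) {x : E4}
    (hζ : DifferentiableAt ℝ ζ x) :
    KerrSchild.multiplierBulk (fun _ ↦ Kerr.etaComp) (fun y α ↦ u α + ζ y * W α) w x =
      (∑ μ, (∑ ν, Kerr.etaComp μ ν * fderiv ℝ w x (E4.basisVector ν)) *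
          fderiv ℝ ζ x (E4.basisVector μ)) * (∑ α, W α * fderiv ℝ w x (E4.basisVector α)) -
        2⁻¹ * (∑ μ, W μ * fderiv ℝ ζ x (E4.basisVector μ)) *
          ∑ α, ∑ β, Kerr.etaComp α β * fderiv ℝ w x (E4.basisVector α) *
            fderiv ℝ w x (E4.basisVector β) := by
  have hd : ∀ β, fderiv ℝ (fun y ↦ u β + ζ y * W β) x = W β • fderiv ℝ ζ x := fun β ↦
    ((hζ.hasFDerivAt.mul_const (W β)).const_add (u β)).fderiv
  have hG : ∀ α β, fderiv ℝ (fun _ : E4 ↦ Kerr.etaComp α β) x = 0 := fun α β ↦ by simp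
  simp only [KerrSchild.multiplierBulk, hd, hG, FunLike.coe_smul, Pi.smul_apply,
    smul_eq_mul, FunLike.coe_zero, Pi.zero_apply]
  -- name the atoms and expand the finite sums
  obtain ⟨p, hp⟩ : ∃ p : Fin 4 → ℝ, ∀ β, fderiv ℝ w x (E4.basisVector β) = p β := ⟨_, fun _ ↦ rfl⟩
  obtain ⟨c, hc⟩ : ∃ c : Fin 4 → ℝ, ∀ μ, fderiv ℝ ζ x (E4.basisVector μ) = c μ := ⟨_, fun _ ↦ rfl⟩
  simp only [hp, hc]
  simp only [Fin.sum_univ_four, Fin.isValue]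
  ring

/-- **The mid-frame wall bulk identity.** In the mid-frame of a receding pair the blend direction
`W = u₂ − u₁ = κ ŵ` is purely spatial along a unit vector `ŵ` (`ŵ⁰ = 0`), and for a wall at rest
in that frame `dζ = ζ′ ŵ♭`; then
`K^{u + ζW} = κ ζ′ [ (∂_ŵ w)² − ½ ∑ η^{αβ} ∂_α w ∂_β w ]`. [folklore] -/
theorem multiplierBulk_eta_wall (u W ŵ : Fin 4 → ℝ) {κ ζ' : ℝ} (hŵ0 : ŵ 0 = 0)
    (hŵ1 : ŵ 1 ^ 2 + ŵ 2 ^ 2 + ŵ 3 ^ 2 = 1) (hW : ∀ μ, W μ = κ * ŵ μ)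
    {ζ : E4 → ℝ} (w : E4 → ℝ) {x : E4} (hζ : DifferentiableAt ℝ ζ x)
    (hdζ : ∀ μ, fderiv ℝ ζ x (E4.basisVector μ) = ζ' * ŵ μ) :
    KerrSchild.multiplierBulk (fun _ ↦ Kerr.etaComp) (fun y α ↦ u α + ζ y * W α) w x =
      κ * ζ' * ((∑ μ, ŵ μ * fderiv ℝ w x (E4.basisVector μ)) ^ 2 -
        2⁻¹ * ∑ α, ∑ β, Kerr.etaComp α β * fderiv ℝ w x (E4.basisVector α) *
          fderiv ℝ w x (E4.basisVector β)) := by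
  rw [multiplierBulk_eta_blend u W w hζ]
  obtain ⟨p, hp⟩ : ∃ p : Fin 4 → ℝ, ∀ β, fderiv ℝ w x (E4.basisVector β) = p β := ⟨_, fun _ ↦ rfl⟩
  simp only [hp, hdζ, hW, KerrSchild.etaComp_eq, Fin.sum_univ_four, Fin.isValue]
  simp only [show (1 : Fin 4) ≠ 0 from by decide, show (2 : Fin 4) ≠ 0 from by decide,
    show (3 : Fin 4) ≠ 0 from by decide, show (0 : Fin 4) ≠ 1 from by decide,
    show (0 : Fin 4) ≠ 2 from by decide, show (0 : Fin 4) ≠ 3 from by decide,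
    show (1 : Fin 4) ≠ 2 from by decide, show (1 : Fin 4) ≠ 3 from by decide,
    show (2 : Fin 4) ≠ 1 from by decide, show (2 : Fin 4) ≠ 3 from by decide,
    show (3 : Fin 4) ≠ 1 from by decide, show (3 : Fin 4) ≠ 2 from by decide,
    if_true, if_false, hŵ0]
  linear_combination (-2⁻¹ * κ * ζ' * (-(p 0) ^ 2 + p 1 ^ 2 + p 2 ^ 2 + p 3 ^ 2)) * hŵ1

/-- **Energy form of the wall bulk**: with `p_μ = ∂_μ w`,
`K = ½ κ ζ′ [ p₀² + 2 (ŵ·p⃗)² − |p⃗|² ] = ½ κ ζ′ [ (∂₀ w)² + (∂_ŵ w)² − |∇_⊥ w|² ]`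
(`η = diag(−1,1,1,1)`). [folklore] -/
theorem multiplierBulk_eta_wall_energyForm (u W ŵ : Fin 4 → ℝ) {κ ζ' : ℝ} (hŵ0 : ŵ 0 = 0)
    (hŵ1 : ŵ 1 ^ 2 + ŵ 2 ^ 2 + ŵ 3 ^ 2 = 1) (hW : ∀ μ, W μ = κ * ŵ μ)
    {ζ : E4 → ℝ} (w : E4 → ℝ) {x : E4} (hζ : DifferentiableAt ℝ ζ x)
    (hdζ : ∀ μ, fderiv ℝ ζ x (E4.basisVector μ) = ζ' * ŵ μ) :
    KerrSchild.multiplierBulk (fun _ ↦ Kerr.etaComp) (fun y α ↦ u α + ζ y * W α) w x =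
      2⁻¹ * κ * ζ' * (fderiv ℝ w x (E4.basisVector 0) ^ 2 +
        2 * (∑ μ, ŵ μ * fderiv ℝ w x (E4.basisVector μ)) ^ 2 -
        (fderiv ℝ w x (E4.basisVector 1) ^ 2 + fderiv ℝ w x (E4.basisVector 2) ^ 2 +
          fderiv ℝ w x (E4.basisVector 3) ^ 2)) := by
  rw [multiplierBulk_eta_wall u W ŵ hŵ0 hŵ1 hW w hζ hdζ, sum_sum_etaComp_fderiv w x]
  ring

/-- **The Doppler sign for null gradients.** If `dw` is null at `x` (`∑ η^{αβ} ∂_α w ∂_β w = 0`: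
geometric optics, null dust) then the wall bulk is the perfect square `κ ζ′ (∂_ŵ w)²`, hence
nonnegative when `κ ζ′ ≥ 0` (receding pair, increasing transition): every wall crossing lowers the
blended multi-frame energy. [folklore] -/
theorem multiplierBulk_eta_wall_nonneg_of_null (u W ŵ : Fin 4 → ℝ) {κ ζ' : ℝ} (hŵ0 : ŵ 0 = 0)
    (hŵ1 : ŵ 1 ^ 2 + ŵ 2 ^ 2 + ŵ 3 ^ 2 = 1) (hW : ∀ μ, W μ = κ * ŵ μ)
    {ζ : E4 → ℝ} (w : E4 → ℝ) {x : E4} (hζ : DifferentiableAt ℝ ζ x)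
    (hdζ : ∀ μ, fderiv ℝ ζ x (E4.basisVector μ) = ζ' * ŵ μ) (hκ : 0 ≤ κ * ζ')
    (hnull : ∑ α, ∑ β, Kerr.etaComp α β * fderiv ℝ w x (E4.basisVector α) *
      fderiv ℝ w x (E4.basisVector β) = 0) :
    KerrSchild.multiplierBulk (fun _ ↦ Kerr.etaComp) (fun y α ↦ u α + ζ y * W α) w x =
        κ * ζ' * (∑ μ, ŵ μ * fderiv ℝ w x (E4.basisVector μ)) ^ 2 ∧
      0 ≤ KerrSchild.multiplierBulk (fun _ ↦ Kerr.etaComp) (fun y α ↦ u α + ζ y * W α) w x := by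
  have h := multiplierBulk_eta_wall u W ŵ hŵ0 hŵ1 hW w hζ hdζ
  rw [hnull, mul_zero, sub_zero] at h
  exact ⟨h, h ▸ mul_nonneg hκ (sq_nonneg _)⟩

end Summit.FinalStateConjecture.FinalStateConjecture.Cruxes.AdiabaticMultiKerrILED.Sketch

end
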